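import Mathlib.NumberTheory.Transcendental.Liouville.LiouvilleWith
import Mathlib.Analysis.SpecialFunctions.Pow.Asymptotics
import Literature.NumberTheory.Transcendental.CalegariDimitrovTangL2Chi3
import HarnessLib

/-!
# An effective irrationality measure of `L(2, χ₋₃)` (Calegari–Dimitrov–Tang 2025, Theorem 4)

Topic `Literature/NumberTheory/Irrationality/CalegariDimitrovTang2025`. Source: F. Calegari, V. Dimitrov,
Y. Tang, *Arithmetic holonomy bounds and effective Diophantine approximation*, arXiv:2510.04156 (2025; ICM 2026
lecture) [CalegariDimitrovTang2025Effective]. READ ON THE PAGE (held text `paper:arxiv-2510.04156`, §5.1, chunk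
p0017): "**Theorem 4.** For all `p/q ∈ ℚ` except possibly a finite and computable list, we have
`|L(2,χ₋₃) − p/q| > 1/q^{24781}`. The same theorem (and proof) holds with `L(2,χ₋₃)` replaced by any
`ℚ`-linear combination of `L(2,χ₋₃)` and `π²`." (§5.1: "making one of the main irrationality results of [L2chi]
effective"; the exponent comes from (5.1): `14 < 11.845/(log(256·5448339453535586608000000000/
8658833407565631122430056127) − (27/80 + 191/49) − log(11614)(κ − 1/4)/κ²)`, RHS `→ 13.9938… < 14`.)
The companion `2`-adic result of §5.2 (Theorem 5, `ζ₂(5)`) is the tree's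
`Literature.NumberTheory.Irrationality.PAdicZetaValues.calegariDimitrovTang2025_theorem5`; the
ineffective linear independence of `1, π², L(2,χ₋₃)` (CDT 2024, Theorem 1) is
`Literature.NumberTheory.Transcendental.calegariDimitrovTang_linearIndependent`, whose glue real number
`L2chi3 = Σ_{n≥0} (1/(3n+1)² − 1/(3n+2)²)` we reuse.

## Contents

* `EffectiveMeasure x` — the printed shape: there is a finite set `S ⊂ ℚ` such that
  `|x − m/q| > 1/q^{24781}` for all integers `m` and `q ≥ 1` with `m/q ∉ S` (all representations `m/q`;
  equivalent to the reduced-fraction reading since `q ≥ den(m/q)`; "computable" is not expressible and is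
  dropped — a weakening of the hypothesis-free conclusion, not of the theorem).
* `theorem4` — named fact (statement only): `EffectiveMeasure L2chi3`.
* `theorem4_combination` — named fact (statement only): `EffectiveMeasure (a·L2chi3 + b·π²)` for rational
  `(a, b) ≠ (0, 0)` (the sentence after Theorem 4; the excluded pair `(0,0)` gives the rational number `0`,
  for which the display is trivially false — the only reading under which the printed sentence is meaningful).
* PROVED: `not_liouvilleWith_of_effectiveMeasure` — the printed shape implies `μ(x) ≤ 24781` in the tree's
  rendering (`¬ LiouvilleWith p x` for every `p > 24781`, as in `ZeilbergerZudilin2020/PiMeasure.lean`);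
  `theorem4.irrationalityExponent_le`, `theorem4_combination.irrationalityExponent_le`,
  `theorem4_of_combination` (Theorem 4 is the case `(a,b) = (1,0)`).

WHAT THIS IS NOT: nothing about `ζ(5)`; an (enormous but effective) measure record for `L(2,χ₋₃)`, the
first for this number; used as a hypothesis nowhere.
-/

noncomputable section

open Filter Topology

namespace Literature.NumberTheory.Irrationality.CalegariDimitrovTang2025

open Literature.NumberTheory.Transcendental (L2chi3)

/-- The printed shape of Theorem 4 for a real number `x`: outside a finite set of rationals,
`|x − m/q| > 1/q^{24781}` (`m ∈ ℤ`, `q ≥ 1`). [cite: CalegariDimitrovTang2025Effective, Theorem 4] -/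
def EffectiveMeasure (x : ℝ) : Prop :=
  ∃ S : Finset ℚ, ∀ (m : ℤ) (q : ℕ), 0 < q → ((m : ℚ) / q) ∉ S →
    1 / (q : ℝ) ^ (24781 : ℕ) < |x - m / q|

/-- **Theorem 4** (Calegari–Dimitrov–Tang 2025), as printed: "For all `p/q ∈ ℚ` except possibly a finite and
computable list, we have `|L(2,χ₋₃) − p/q| > 1/q^{24781}`." Named fact (statement only; "computable"
dropped). [cite: CalegariDimitrovTang2025Effective, Theorem 4] -/
def theorem4 : Prop :=
  EffectiveMeasure L2chi3

/-- The sentence after Theorem 4: "The same theorem (and proof) holds with `L(2,χ₋₃)` replaced by any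
`ℚ`-linear combination of `L(2,χ₋₃)` and `π²`" — typed for `(a, b) ≠ (0, 0)`. Named fact (statement only).
[cite: CalegariDimitrovTang2025Effective, §5.1 (sentence after Theorem 4)] -/
def theorem4_combination : Prop :=
  ∀ a b : ℚ, (a ≠ 0 ∨ b ≠ 0) → EffectiveMeasure ((a : ℝ) * L2chi3 + (b : ℝ) * Real.pi ^ 2)

/-- Theorem 4 is the case `(a, b) = (1, 0)` of the combination statement.
[cite: CalegariDimitrovTang2025Effective, Theorem 4] -/
theorem theorem4_of_combination (h : theorem4_combination) : theorem4 := by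
  have := h 1 0 (Or.inl one_ne_zero)
  unfold theorem4
  simpa using this

/-- The printed effective shape implies the irrationality-exponent bound `μ(x) ≤ 24781` in the tree's
rendering: `x` is not `p`-Liouville for any `p > 24781`. (If `|x − m/n| < C/n^p` for infinitely many `n`,
then for large `n` either `m/n` lies in the finite exceptional set — impossible once `C/n^p` is below the
distances from `x` to that set — or `1/n^{24781} < |x − m/n| < C/n^p ≤ 1/n^{24781}`.)
[cite: CalegariDimitrovTang2025Effective, §2.2 (definition of the irrationality measure) and Theorem 4] -/
theorem not_liouvilleWith_of_effectiveMeasure {x : ℝ} (h : EffectiveMeasure x) {p : ℝ}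
    (hp : 24781 < p) : ¬ LiouvilleWith p x := by
  rintro ⟨C, hC⟩
  obtain ⟨S, hS⟩ := h
  have hlim : Tendsto (fun n : ℕ => C / (n : ℝ) ^ p) atTop (𝓝 0) :=
    tendsto_const_nhds.div_atTop ((tendsto_rpow_atTop (by linarith)).comp tendsto_natCast_atTop_atTop)
  have h1 : ∀ᶠ n : ℕ in atTop, 1 ≤ n := eventually_ge_atTop 1
  have h2 : ∀ᶠ n : ℕ in atTop, C / (n : ℝ) ^ p ≤ 1 / (n : ℝ) ^ (24781 : ℕ) := by
    have hC' : ∀ᶠ n : ℕ in atTop, C ≤ (n : ℝ) ^ (p - 24781) :=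
      ((tendsto_rpow_atTop (by linarith : 0 < p - 24781)).comp
        tendsto_natCast_atTop_atTop).eventually_ge_atTop C
    filter_upwards [hC', h1] with n hn hn1
    have hn0 : (0 : ℝ) < n := by exact_mod_cast hn1
    have hA : (0 : ℝ) < (n : ℝ) ^ (24781 : ℕ) := pow_pos hn0 _
    have hB : (0 : ℝ) < (n : ℝ) ^ (p - 24781) := Real.rpow_pos_of_pos hn0 _
    have hsplit : (n : ℝ) ^ p = (n : ℝ) ^ (24781 : ℕ) * (n : ℝ) ^ (p - 24781) := by
      rw [← Real.rpow_natCast, ← Real.rpow_add hn0]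
      congr 1
      push_cast
      ring
    rw [hsplit, show C / ((n : ℝ) ^ (24781 : ℕ) * (n : ℝ) ^ (p - 24781)) =
      (C / (n : ℝ) ^ (p - 24781)) / (n : ℝ) ^ (24781 : ℕ) by ring]
    exact div_le_div_of_nonneg_right ((div_le_one hB).mpr hn) hA.le
  have h3 : ∀ᶠ n : ℕ in atTop, ∀ r ∈ S, x ≠ r → C / (n : ℝ) ^ p < |x - r| := by
    refine S.eventually_all.mpr fun r _ => ?_
    by_cases hx : x = r
    · exact Eventually.of_forall fun n h => (h hx).elim
    · have hpos : 0 < |x - r| := abs_pos.mpr (sub_ne_zero.mpr hx)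
      exact (hlim.eventually (gt_mem_nhds hpos)).mono fun n hn _ => hn
  obtain ⟨n, ⟨m, hne, hlt⟩, hn1, hn2, hn3⟩ := (hC.and_eventually (h1.and (h2.and h3))).exists
  by_cases hmem : ((m : ℚ) / n : ℚ) ∈ S
  · have h' := hn3 _ hmem (by push_cast; exact hne)
    push_cast at h'
    linarith
  · have h' := hS m n hn1 hmem
    linarith

/-- Theorem 4 in the tree's rendering: `μ(L(2,χ₋₃)) ≤ 24781`, i.e. `L(2,χ₋₃)` is not `p`-Liouville for any
`p > 24781`. [cite: CalegariDimitrovTang2025Effective, Theorem 4] -/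
theorem theorem4.irrationalityExponent_le (h : theorem4) {p : ℝ} (hp : 24781 < p) :
    ¬ LiouvilleWith p L2chi3 :=
  not_liouvilleWith_of_effectiveMeasure h hp

/-- The combination statement in the tree's rendering: `μ(a·L(2,χ₋₃) + b·π²) ≤ 24781` for rational
`(a, b) ≠ (0, 0)`. [cite: CalegariDimitrovTang2025Effective, §5.1 (sentence after Theorem 4)] -/
theorem theorem4_combination.irrationalityExponent_le (h : theorem4_combination) {a b : ℚ}
    (hab : a ≠ 0 ∨ b ≠ 0) {p : ℝ} (hp : 24781 < p) :
    ¬ LiouvilleWith p ((a : ℝ) * L2chi3 + (b : ℝ) * Real.pi ^ 2) :=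
  not_liouvilleWith_of_effectiveMeasure (h a b hab) hp

end Literature.NumberTheory.Irrationality.CalegariDimitrovTang2025
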